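import Summits.BirchSwinnertonDyer.Rank1Residual.P2.CornerFTwoModelIsogenyEdges
import HarnessLib

/-!
# Leaf CornerF @ `p = 2` — THE MODEL ATLAS, file 10 (cell `bsd-print-cf2`, D-0131 (2) print tier,
# typer ty2): the QUARTIC conjunct of the ramified crux IN TWIST-FAMILY CURRENCY
# (`y² = x³ + Ax`, `A, −A ∉ ℤ²` = the square-free twist families of `y² = x³ + A₀x`, `A₀ ∉ {1, −1}`)

HONEST FRAMING (cell `bsd-print-cf2`, HOME `run/shared/lean/pub/bsd-print-cf2/`, verbatim in every
file): the partition leaf is `CornerF W 2` — `W/ℚ` globally minimal elliptic WITH CM and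
`ord_{s=1} L(E,s) = 1`, at the prime `2` (rung leaf `WAllCornerFTwo`; OPEN AS A CLASS). Nothing
class-wide is closed here. Files 2/5 (`CornerFTwoModelClasses`, `CornerFTwoModelIsogenyEdges`) write the
ramified class (crux stmt-BirchSwinnertonDyer-20362, child 20509 `RamifiedOffTYZOfFacts`) as
`E_n ∧ QUARTIC ∧ (j = 287496 twists) ∧ (cm8 twists)` with the quartic conjunct
"`∀ A ∈ ℤ∖{0}`, `−A ∉ ℤ²`, `A ∉ ℤ²`: `BSD(W,2)` for every globally minimal model `W` of `y² = x³ + Ax` of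
analytic rank one". THIS FILE rewrites that conjunct in the currency of the printed twist theorems
(Shu–Zhai 2021, Kriz–Li 2019: a BASE curve and its quadratic twists): writing `A = A₀m²` with `A₀`
square-free (`Nat.sq_mul_squarefree`), `y² = x³ + Ax = (y² = x³ + A₀x)^{(m)}` on the nose
(`Atlas.quadraticTwist_quartic`), and `A, −A ∉ ℤ²` iff `A₀ ∉ {1, −1}`; so the conjunct is the conjunction,
over the square-free `A₀ ∉ {1, −1}`, of "`BSD(·,2)` on the analytic-rank-one minimal models of the
twists of `y² = x³ + A₀x`" (`quarticConjunct_iff_twistFamilies`). PRINT inside it (lit g3 DOSSIER §16):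
the base `A₀ = 2` is `256c1` (`ShuZhai2021.curve256c1`; Shu–Zhai Thms 1.2/1.4/4.10 give `r_an = 1 ∧
BSD(W,2)` on its twists by `−pM`, `p ≡ 7 (mod 8)`, `M` an even product of primes `≡ 5 (mod 8)` — the
setting is ty2's `P2/ShuZhaiTwoFiftySixCurve.lean`, the slice p2 g3's); `A₀ = −2` is `256b1` (Kriz–Li
MRL 2019: `r_an = 1` for prime twists, no BSD₂); every other `A₀` is printless (§16.3). Fact-free: NO
arithmetic fact, NO definition, NO named fact (D-0026); `beyond-print: NO` (interface).

References: [SilvermanAEC2009] X.5 Prop. 5.4 (ii) and Cor. 5.4.1; [ShuZhai2021] Thms 1.2/1.4/4.10;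
[KrizLi2019] (MRL 26) Ex. 2.1/2.3; HOME/DOSSIER.md §16; `P2/CornerFTwoModelIsogenyEdges.lean` (file 5).
-/

noncomputable section

open scoped Classical

open WeierstrassCurve Literature.NumberTheory.EllipticCurves
  Literature.NumberTheory.EllipticCurves.Rank1Residual

set_option autoImplicit false

namespace Summit.BirchSwinnertonDyer.Rank1Residual.P2.CornerFTwo

namespace Atlas

/-- **`(y² = x³ + A₀x)^{(d)} = (y² = x³ + A₀d²x)` on the nose** (tree `quadraticTwist`: `b₂ = 0`,
`b₄ = 2A₀`, `b₆ = 0`). [cite: SilvermanAEC2009, X.5 Prop. 5.4 (ii)] -/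
theorem quadraticTwist_quartic (A₀ d : ℚ) :
    (⟨0, 0, 0, A₀, 0⟩ : WeierstrassCurve ℚ).quadraticTwist d = ⟨0, 0, 0, A₀ * d ^ 2, 0⟩ := by
  ext <;> simp [WeierstrassCurve.quadraticTwist, WeierstrassCurve.b₂, WeierstrassCurve.b₄,
    WeierstrassCurve.b₆]
  ring

/-- A square-free integer is square-free up to sign. [folklore] -/
theorem squarefree_neg_of_squarefree {A₀ : ℤ} (hA₀ : Squarefree A₀) : Squarefree (-A₀) :=
  Int.squarefree_natAbs.1 (by rw [Int.natAbs_neg]; exact Int.squarefree_natAbs.2 hA₀)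

/-- A square-free integer times a nonzero square is a square only if the square-free part is `1`.
[folklore] -/
theorem eq_one_of_squarefree_of_isSquare_mul_sq {A₀ m : ℤ} (hA₀ : Squarefree A₀) (hm : m ≠ 0)
    (h : IsSquare (A₀ * m ^ 2)) : A₀ = 1 := by
  obtain ⟨r, hr⟩ := h
  -- `m² ∣ r²`, so `m ∣ r`
  have hdvd : m ^ 2 ∣ r ^ 2 := ⟨A₀, by rw [sq r, ← hr]; ring⟩
  obtain ⟨k, rfl⟩ := (Int.pow_dvd_pow_iff two_ne_zero).mp hdvd
  have hA : A₀ = k * k := by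
    have h2 : m ^ 2 * A₀ = m ^ 2 * (k * k) := by rw [mul_comm, hr]; ring
    exact mul_left_cancel₀ (pow_ne_zero 2 hm) h2
  have hk : IsUnit k := hA₀ k ⟨1, by rw [hA, mul_one]⟩
  rcases Int.isUnit_iff.mp hk with rfl | rfl <;> simp [hA]

end Atlas

open Atlas

/-- **THE QUARTIC CONJUNCT IN TWIST-FAMILY CURRENCY.** The quartic conjunct of the ramified class
(`CornerFTwo.wAllCornerFTwoRamified_iff_models_of_transport`, conjunct (2): `y² = x³ + Ax`, `A ∈ ℤ∖{0}`,
`−A ∉ ℤ²`, `A ∉ ℤ²`) ⟺ for every SQUARE-FREE `A₀ ∉ {1, −1}` and every `d ∈ ℤ∖{0}`, `BSD(W,2)` for every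
globally minimal model `W` of analytic rank one of the quadratic twist `(y² = x³ + A₀x)^{(d)}` — one
base `y² = x³ + A₀x` per square class; `A₀ = −1` is the `E_n`-conjunct, `A₀ = 1` its `2`-isogenous shadow
(file 5), both excluded here. Print: `A₀ = 2` = `256c1` (Shu–Zhai at `256c1`, DOSSIER §16), `A₀ = −2` =
`256b1` (rank only); nothing else. [cite: SilvermanAEC2009, X.5 Prop. 5.4 (ii) and Cor. 5.4.1] -/
theorem quarticConjunct_iff_twistFamilies :
    (∀ A : ℤ, A ≠ 0 → ¬ IsSquare (-A) → ¬ IsSquare A →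
        ∀ (W : WeierstrassCurve ℚ) [W.IsElliptic] [W.IsGloballyMinimal],
          (∃ C : VariableChange ℚ, C • (⟨0, 0, 0, (A : ℚ), 0⟩ : WeierstrassCurve ℚ) = W) →
          W.analyticRank = 1 → BSDp W 2) ↔
      (∀ A₀ : ℤ, Squarefree A₀ → A₀ ≠ 1 → A₀ ≠ -1 → ∀ d : ℤ, d ≠ 0 →
        ∀ (W : WeierstrassCurve ℚ) [W.IsElliptic] [W.IsGloballyMinimal],
          (∃ C : VariableChange ℚ,
            C • (⟨0, 0, 0, (A₀ : ℚ), 0⟩ : WeierstrassCurve ℚ).quadraticTwist (d : ℚ) = W) →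
          W.analyticRank = 1 → BSDp W 2) := by
  constructor
  · intro h A₀ hA₀ h1 hm1 d hd W _ _ hW hr
    obtain ⟨C, hC⟩ := hW
    rw [quadraticTwist_quartic] at hC
    have e : ((A₀ : ℚ)) * (d : ℚ) ^ 2 = ((A₀ * d ^ 2 : ℤ) : ℚ) := by push_cast; ring
    rw [e] at hC
    refine h (A₀ * d ^ 2) (mul_ne_zero hA₀.ne_zero (pow_ne_zero 2 hd)) ?_ ?_ W ⟨C, hC⟩ hr
    · intro hsq
      have : -A₀ = 1 :=
        eq_one_of_squarefree_of_isSquare_mul_sq (squarefree_neg_of_squarefree hA₀) hd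
          (by rw [neg_mul]; exact hsq)
      omega
    · exact fun hsq => h1 (eq_one_of_squarefree_of_isSquare_mul_sq hA₀ hd hsq)
  · intro h A hA hneg hpos W _ _ hW hr
    obtain ⟨C, hC⟩ := hW
    obtain ⟨A₀, m, hm, hA₀, rfl⟩ := Literature.NumberTheory.EllipticCurves.exists_squarefree_mul_sq hA
    have hm' : (m : ℤ) ≠ 0 := by exact_mod_cast hm.ne'
    have h1 : A₀ ≠ 1 := by
      rintro rfl; exact hpos ⟨m, by ring⟩
    have hm1 : A₀ ≠ -1 := by
      rintro rfl; exact hneg ⟨m, by ring⟩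
    refine h A₀ hA₀ h1 hm1 m hm' W ⟨C, ?_⟩ hr
    rw [quadraticTwist_quartic, ← hC]
    congr 1
    push_cast; ring_nf

end Summit.BirchSwinnertonDyer.Rank1Residual.P2.CornerFTwo

end
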